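import Mathlib
import HarnessLib
import Literature.MathematicalPhysics.StatisticalMechanics.TorusFRDStepKernelSegment

/-!
# `StepKernelBounds` for three-point CONVEX COMBINATIONS of torus kernels
# (the midpoint pair of the `ℓ = 2` kernel comparison, [ABKM19] Lemma 7.7 / Lemma 12.6)

The second-order (`ℓ = 2`) comparison of the Gaussian expectations `E_{𝒞_{1+q,k+1}}` along a line
`q, q+h, q+2h` of tuning parameters splits as
`E_{C₂} − 2E_{C₁} + E_{C₀} = [E_{C₂} − 2E_{C̄} + E_{C₀}] + 2[E_{C̄} − E_{C₁}]`, `C̄ = ½(C₀ + C₂)`,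
and the second bracket is a FIRST-order comparison for the pair `(C̄, C₁)` whose segment
`C₁ + t(C̄ − C₁) = (t/2)C₀ + (1−t)C₁ + (t/2)C₂` is a three-point convex combination of torus kernels.
The hypotheses of Lemma 7.7 (`AbkmWeightBounds.stepKernelBounds_const_mul`) are convex in the kernel, so:

* `fourierCoeff_convex3`, `re_fourierCoeff_convex3`, `gradCov_convex3`, `convex3_even` — linearity;
* `AbkmWeightBounds.stepKernelBounds_const_mul_convex3` — abstract: three even kernels with nonnegative
  dominated multipliers and `γ`-bounds give `StepKernelBounds` for `p·(a𝒞₀ + b𝒞₁ + c𝒞₂)`, `a,b,c ≥ 0`,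
  `a + b + c = 1`;
* **`stepKernelBounds_const_mul_convex3_of_torusFRD`** — for one `TorusFRD` package and three symmetric
  tuning parameters in the ball `Σ|·| ≤ T₀ ≤ ½` (constants exactly as in
  `stepKernelBounds_const_mul_kernelSeg_of_torusFRD`).

Everything is proved; no named fact.

## References
* S. Adams, S. Buchholz, R. Kotecký, S. Müller, arXiv:1910.13564, Lemma 7.7, Lemma 8.4, Lemma 12.6
  [AdamsBuchholzKoteckyMuller2019].
* S. Buchholz, J. Funct. Anal. 275 (2018), §2 [Buchholz2016].
-/

noncomputable section

namespace Literature.MathematicalPhysics.StatisticalMechanics.GradientRG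

open scoped BigOperators
open Real Set Finset MeasureTheory
open Literature.MathematicalPhysics.StatisticalMechanics.GradientFRD
  (fourierCoeff cExt cExt_of_mem IsElliptic IsUnitSymm InShell iterDiff supNorm conv ellOp isElliptic_one
    exists_inShell re_fourierCoeff_zero_of_sum_eq_zero)
open Literature.MathematicalPhysics.StatisticalMechanics.TorusPolymer (IsPolymer numBlocks)

variable {d M : ℕ} [NeZero M]

/-! ## Linearity along three-point convex combinations -/

/-- The Fourier coefficients of `a𝒞₀ + b𝒞₁ + c𝒞₂`. [cite: Buchholz2016, §2 (2.14)] -/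
theorem fourierCoeff_convex3 (𝒞₀ 𝒞₁ 𝒞₂ : (Fin d → ZMod M) → ℝ) (a b c : ℝ) (κ : Fin d → ZMod M) :
    fourierCoeff (fun x => a * 𝒞₀ x + b * 𝒞₁ x + c * 𝒞₂ x) κ =
      (a : ℂ) * fourierCoeff 𝒞₀ κ + (b : ℂ) * fourierCoeff 𝒞₁ κ + (c : ℂ) * fourierCoeff 𝒞₂ κ := by
  unfold GradientFRD.fourierCoeff
  rw [Finset.mul_sum, Finset.mul_sum, Finset.mul_sum, ← Finset.sum_add_distrib, ← Finset.sum_add_distrib]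
  refine Finset.sum_congr rfl fun x _ => ?_
  push_cast
  ring

/-- Real parts of the multipliers of `a𝒞₀ + b𝒞₁ + c𝒞₂`. [cite: Buchholz2016, §2 (2.14)] -/
theorem re_fourierCoeff_convex3 (𝒞₀ 𝒞₁ 𝒞₂ : (Fin d → ZMod M) → ℝ) (a b c : ℝ) (κ : Fin d → ZMod M) :
    (fourierCoeff (fun x => a * 𝒞₀ x + b * 𝒞₁ x + c * 𝒞₂ x) κ).re =
      a * (fourierCoeff 𝒞₀ κ).re + b * (fourierCoeff 𝒞₁ κ).re + c * (fourierCoeff 𝒞₂ κ).re := by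
  rw [fourierCoeff_convex3]
  simp only [Complex.add_re, Complex.re_ofReal_mul]

omit [NeZero M] in
/-- `γ_q` of `a𝒞₀ + b𝒞₁ + c𝒞₂`. [cite: AdamsBuchholzKoteckyMuller2019, Theorem 6.8 (6.64)] -/
theorem gradCov_convex3 (𝒞₀ 𝒞₁ 𝒞₂ : (Fin d → ZMod M) → ℝ) (a b c : ℝ) (q : quadIndex d) :
    gradCov (fun x => a * 𝒞₀ x + b * 𝒞₁ x + c * 𝒞₂ x) q = a * gradCov 𝒞₀ q + b * gradCov 𝒞₁ q + c * gradCov 𝒞₂ q := by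
  unfold gradCov; ring

omit [NeZero M] in
/-- A combination of even kernels is even. [cite: Buchholz2016, §1 (1.5)] -/
theorem convex3_even {𝒞₀ 𝒞₁ 𝒞₂ : (Fin d → ZMod M) → ℝ} (he₀ : ∀ x, 𝒞₀ (-x) = 𝒞₀ x)
    (he₁ : ∀ x, 𝒞₁ (-x) = 𝒞₁ x) (he₂ : ∀ x, 𝒞₂ (-x) = 𝒞₂ x) (a b c : ℝ) (x : Fin d → ZMod M) :
    a * 𝒞₀ (-x) + b * 𝒞₁ (-x) + c * 𝒞₂ (-x) = a * 𝒞₀ x + b * 𝒞₁ x + c * 𝒞₂ x := by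
  rw [he₀, he₁, he₂]

/-! ## The abstract convexity statement -/

/-- **Convexity of the hypotheses of Lemma 7.7**: three even kernels with nonnegative multipliers
dominated by `(1+ρ)𝒞^{(0)}_{k+1}` (after dilation by `p`) and `γ`-constants `C₂` give `StepKernelBounds`
for every dilated convex combination `p·(a𝒞₀ + b𝒞₁ + c𝒞₂)`, `a, b, c ≥ 0`, `a + b + c = 1`, with the
same constants. [cite: AdamsBuchholzKoteckyMuller2019, Lemma 7.7 / Lemma 8.4] -/
theorem AbkmWeightBounds.stepKernelBounds_const_mul_convex3 {L N Mord R n : ℕ}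
    {θbar lam μ δ₁ δ₀ A𝒫 : ℝ} {𝒞 : ℕ → (Fin d → ZMod M) → ℝ}
    (hd : 2 ≤ d) (hMord : 1 ≤ Mord) (hMR : Mord ≤ R) (hLodd : Odd L) (hL : 2 ^ (d + 3) + 16 * R ≤ L)
    (hθbar : 0 < θbar) (hlam : 0 < lam)
    (hB : AbkmWeightBounds L N Mord R n θbar lam μ δ₁ δ₀ A𝒫 𝒞
      (abkmWeightData L N Mord R θbar (schedDelta δ₀ δ₁ N) 𝒞))
    (hn : 2 * Mord ≤ n) {Cα : (Fin d → ℕ) → ℝ}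
    (hCα : ∀ j, 1 ≤ j → j ≤ N + 1 → ∀ θ' : Fin d → ℕ, ∑ i, θ' i ≤ n →
      ∀ x, |GradientFRD.iterDiff θ' (𝒞 j) x| ≤ Cα θ' / (L : ℝ) ^ ((j - 1) * (d - 2 + ∑ i, θ' i)))
    {k : ℕ} (hk : k + 1 ≤ N + 1) {ρ : ℝ} (hρ0 : 0 ≤ ρ) (hρ : ρ < θbar)
    {𝒞₀ 𝒞₁ 𝒞₂ : (Fin d → ZMod M) → ℝ} (he₀ : ∀ x, 𝒞₀ (-x) = 𝒞₀ x) (he₁ : ∀ x, 𝒞₁ (-x) = 𝒞₁ x)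
    (he₂ : ∀ x, 𝒞₂ (-x) = 𝒞₂ x)
    (hnn₀ : ∀ κ, 0 ≤ (fourierCoeff 𝒞₀ κ).re) (hnn₁ : ∀ κ, 0 ≤ (fourierCoeff 𝒞₁ κ).re)
    (hnn₂ : ∀ κ, 0 ≤ (fourierCoeff 𝒞₂ κ).re)
    {p : ℝ} (hp : 0 ≤ p)
    (hle₀ : ∀ κ, p * (fourierCoeff 𝒞₀ κ).re ≤ (1 + ρ) * cExt N (fun j => fourierCoeff (𝒞 j) κ) (k + 1))
    (hle₁ : ∀ κ, p * (fourierCoeff 𝒞₁ κ).re ≤ (1 + ρ) * cExt N (fun j => fourierCoeff (𝒞 j) κ) (k + 1))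
    (hle₂ : ∀ κ, p * (fourierCoeff 𝒞₂ κ).re ≤ (1 + ρ) * cExt N (fun j => fourierCoeff (𝒞 j) κ) (k + 1))
    {C₂ : ℝ} (hγ₀ : ∀ q : quadIndex d, ((L ^ (d * k) : ℕ) : ℝ) * |gradCov 𝒞₀ q| ≤ C₂)
    (hγ₁ : ∀ q : quadIndex d, ((L ^ (d * k) : ℕ) : ℝ) * |gradCov 𝒞₁ q| ≤ C₂)
    (hγ₂ : ∀ q : quadIndex d, ((L ^ (d * k) : ℕ) : ℝ) * |gradCov 𝒞₂ q| ≤ C₂)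
    {a b c : ℝ} (ha : 0 ≤ a) (hb : 0 ≤ b) (hc : 0 ≤ c) (habc : a + b + c = 1) :
    StepKernelBounds (abkmWeightData L N Mord R θbar (schedDelta δ₀ δ₁ N) 𝒞) L k
      (weightIntConstRho θbar ρ (traceConst d Mord R lam (derivSum d n fun θ' _ => Cα θ'))) (p * C₂)
      (fun x => p * (a * 𝒞₀ x + b * 𝒞₁ x + c * 𝒞₂ x)) := by
  refine AbkmWeightBounds.stepKernelBounds_const_mul hd hMord hMR hLodd hL hθbar hlam hB hn hCα hk hρ0 hρ
    (𝒞q := fun x => a * 𝒞₀ x + b * 𝒞₁ x + c * 𝒞₂ x) (convex3_even he₀ he₁ he₂ a b c) (fun κ => ?_) hp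
    (fun κ => ?_) (fun q => ?_)
  · rw [re_fourierCoeff_convex3]
    exact add_nonneg (add_nonneg (mul_nonneg ha (hnn₀ κ)) (mul_nonneg hb (hnn₁ κ))) (mul_nonneg hc (hnn₂ κ))
  · rw [re_fourierCoeff_convex3]
    have e : p * (a * (fourierCoeff 𝒞₀ κ).re + b * (fourierCoeff 𝒞₁ κ).re + c * (fourierCoeff 𝒞₂ κ).re) =
        a * (p * (fourierCoeff 𝒞₀ κ).re) + b * (p * (fourierCoeff 𝒞₁ κ).re) + c * (p * (fourierCoeff 𝒞₂ κ).re) := by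
      ring
    rw [e]
    calc a * (p * (fourierCoeff 𝒞₀ κ).re) + b * (p * (fourierCoeff 𝒞₁ κ).re) + c * (p * (fourierCoeff 𝒞₂ κ).re)
        ≤ a * ((1 + ρ) * cExt N (fun j => fourierCoeff (𝒞 j) κ) (k + 1)) +
            b * ((1 + ρ) * cExt N (fun j => fourierCoeff (𝒞 j) κ) (k + 1)) +
            c * ((1 + ρ) * cExt N (fun j => fourierCoeff (𝒞 j) κ) (k + 1)) :=
          add_le_add (add_le_add (mul_le_mul_of_nonneg_left (hle₀ κ) ha) (mul_le_mul_of_nonneg_left (hle₁ κ) hb))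
            (mul_le_mul_of_nonneg_left (hle₂ κ) hc)
      _ = (1 + ρ) * cExt N (fun j => fourierCoeff (𝒞 j) κ) (k + 1) := by
          rw [← add_mul, ← add_mul, habc, one_mul]
  · rw [gradCov_convex3]
    have hLk : (0 : ℝ) ≤ ((L ^ (d * k) : ℕ) : ℝ) := Nat.cast_nonneg _
    calc ((L ^ (d * k) : ℕ) : ℝ) * |a * gradCov 𝒞₀ q + b * gradCov 𝒞₁ q + c * gradCov 𝒞₂ q|
        ≤ ((L ^ (d * k) : ℕ) : ℝ) * (a * |gradCov 𝒞₀ q| + b * |gradCov 𝒞₁ q| + c * |gradCov 𝒞₂ q|) := by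
          refine mul_le_mul_of_nonneg_left ?_ hLk
          calc |a * gradCov 𝒞₀ q + b * gradCov 𝒞₁ q + c * gradCov 𝒞₂ q|
              ≤ |a * gradCov 𝒞₀ q + b * gradCov 𝒞₁ q| + |c * gradCov 𝒞₂ q| := abs_add_le _ _
            _ ≤ |a * gradCov 𝒞₀ q| + |b * gradCov 𝒞₁ q| + |c * gradCov 𝒞₂ q| :=
                add_le_add (abs_add_le _ _) le_rfl
            _ = a * |gradCov 𝒞₀ q| + b * |gradCov 𝒞₁ q| + c * |gradCov 𝒞₂ q| := by
                rw [abs_mul, abs_mul, abs_mul, abs_of_nonneg ha, abs_of_nonneg hb, abs_of_nonneg hc]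
      _ = a * (((L ^ (d * k) : ℕ) : ℝ) * |gradCov 𝒞₀ q|) + b * (((L ^ (d * k) : ℕ) : ℝ) * |gradCov 𝒞₁ q|) +
            c * (((L ^ (d * k) : ℕ) : ℝ) * |gradCov 𝒞₂ q|) := by ring
      _ ≤ a * C₂ + b * C₂ + c * C₂ :=
          add_le_add (add_le_add (mul_le_mul_of_nonneg_left (hγ₀ q) ha) (mul_le_mul_of_nonneg_left (hγ₁ q) hb))
            (mul_le_mul_of_nonneg_left (hγ₂ q) hc)
      _ = C₂ := by rw [← add_mul, ← add_mul, habc, one_mul]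

section Package

variable {L N Mord R n ñ : ℕ} {θbar lam μ δ₁ δ₀ A𝒫 : ℝ}
    {𝒞 : Matrix (Fin d) (Fin d) ℝ → ℕ → (Fin d → ZMod M) → ℝ} {Mc : ℕ → ℝ}
    {Cα : (Fin d → ℕ) → ℕ → ℝ} {c C : ℝ} {Cℓ : ℕ → ℝ}

/-- **`StepKernelBounds` for dilated three-point CONVEX COMBINATIONS
`p·(a𝒞_{1+q₀,k+1} + b𝒞_{1+q₁,k+1} + c𝒞_{1+q₂,k+1})`, `a,b,c ≥ 0`, `a+b+c = 1`, of one `TorusFRD` package**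
(relative to the `q = 0` weights): for symmetric `q₀, q₁, q₂` in the ball `Σ|·| ≤ T₀`, `T₀ ≤ ½`,
`K T₀ ≤ log(1+ρ)`, `p ≥ 0`, `p(1+ρ) ≤ 1+ρ''`, `0 ≤ ρ'' < θ̄` — in particular for the midpoint kernel
`C̄ = ½(𝒞_{1+q,k+1} + 𝒞_{1+q+2h,k+1})`, for `𝒞_{1+q+h,k+1}`, and for the segment between them (the pair of
the first-order part of the `ℓ = 2` comparison). [cite: AdamsBuchholzKoteckyMuller2019, Lemma 7.7 / Lemma 12.6] -/
theorem stepKernelBounds_const_mul_convex3_of_torusFRD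
    (hd : 3 ≤ d) (hMord : 1 ≤ Mord) (hMR : Mord ≤ R) (hLodd : Odd L) (hL : 2 ^ (d + 3) + 16 * R ≤ L)
    (hθbar : 0 < θbar) (hlam : 0 < lam) (hn : 2 * Mord ≤ n) (hn2 : 2 ≤ n) (hnñ : n ≤ ñ)
    (hc : 0 < c) (hC1 : 0 ≤ Cℓ 1)
    (hallA : ∀ A : Matrix (Fin d) (Fin d) ℝ, IsElliptic (1 / 2 : ℝ) 2 A →
        (∀ k, 1 ≤ k → k ≤ N + 1 →
          ∑ x : Fin d → ZMod M, 𝒞 A k x = 0 ∧ ∀ x, 𝒞 A k (-x) = 𝒞 A k x) ∧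
        (∀ k, 1 ≤ k → k ≤ N + 1 → ∀ φ : (Fin d → ZMod M) → ℝ, ∑ x, φ x = 0 →
          0 ≤ ∑ x, ∑ y, φ x * 𝒞 A k (x - y) * φ y) ∧
        (∀ φ : (Fin d → ZMod M) → ℝ, ∑ x, φ x = 0 →
          ellOp A (conv (fun x => ∑ k ∈ Finset.Icc 1 (N + 1), 𝒞 A k x) φ) = φ) ∧
        (∀ k, 1 ≤ k → k ≤ N → Mc k ≤ 0 ∧
          ∀ x : Fin d → ZMod M, ((L : ℝ) ^ k) / 2 ≤ (supNorm x : ℝ) →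
            𝒞 A k x = Mc k) ∧
        (∀ k, 1 ≤ k → k ≤ N + 1 → ∀ B : Matrix (Fin d) (Fin d) ℝ, IsUnitSymm B →
          (∃ ε : ℝ, 0 < ε ∧ ∀ x : Fin d → ZMod M,
            ContDiffOn ℝ ⊤ (fun s : ℝ => 𝒞 (A + s • B) k x) (Set.Ioo (-ε) ε)) ∧
          ∀ α : Fin d → ℕ, ∑ i, α i ≤ n → ∀ ℓ : ℕ, ∀ x : Fin d → ZMod M,
            abs (iteratedDeriv ℓ (fun s : ℝ => iterDiff α (𝒞 (A + s • B) k) x) 0)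
              ≤ Cα α ℓ / (L : ℝ) ^ ((k - 1) * (d - 2 + ∑ i, α i))) ∧
        (∀ k, 1 ≤ k → k ≤ N + 1 → ∀ j : ℕ, ∀ κ : Fin d → ZMod M, κ ≠ 0 → InShell L j κ →
          (j < k →
            c / (L : ℝ) ^ (2 * (d + ñ) + 1) * (L : ℝ) ^ (2 * j)
                / (L : ℝ) ^ ((k - j) * (d - 1 + n)) ≤ (fourierCoeff (𝒞 A k) κ).re ∧
            ‖fourierCoeff (𝒞 A k) κ‖
              ≤ C * (L : ℝ) ^ (2 * (d + ñ) + 1) * (L : ℝ) ^ (2 * j)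
                  / (L : ℝ) ^ ((k - j) * (d - 1 + n))) ∧
          (k ≤ j →
            c / (L : ℝ) ^ (2 * (d + ñ) + 1) * (L : ℝ) ^ (2 * k)
                ≤ (fourierCoeff (𝒞 A k) κ).re ∧
            ‖fourierCoeff (𝒞 A k) κ‖ ≤ C * (L : ℝ) ^ (2 * k)) ∧
          ∀ B : Matrix (Fin d) (Fin d) ℝ, IsUnitSymm B → ∀ ℓ : ℕ, 1 ≤ ℓ →
            (j < k →
              ‖iteratedDeriv ℓ (fun s : ℝ => fourierCoeff (𝒞 (A + s • B) k) κ) 0‖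
                ≤ Cℓ ℓ * (L : ℝ) ^ (2 * (d + ñ) + 1) * (L : ℝ) ^ (2 * j)
                    / (L : ℝ) ^ ((k - j) * (d - 1 + ñ))) ∧
            (k ≤ j →
              ‖iteratedDeriv ℓ (fun s : ℝ => fourierCoeff (𝒞 (A + s • B) k) κ) 0‖
                ≤ Cℓ ℓ * (L : ℝ) ^ (2 * k))))
    (hB : AbkmWeightBounds L N Mord R n θbar lam μ δ₁ δ₀ A𝒫 (fun j => 𝒞 1 j)
      (abkmWeightData L N Mord R θbar (schedDelta δ₀ δ₁ N) fun j => 𝒞 1 j))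
    {k : ℕ} (hk : k + 1 ≤ N + 1) {ρ : ℝ} (hρ0 : 0 ≤ ρ)
    {T₀ : ℝ} (hT₀ : T₀ ≤ 1 / 2) (hKT₀ : shellRatioConst c (Cℓ 1) (L : ℝ) d ñ * T₀ ≤ Real.log (1 + ρ))
    {q₀ q₁ q₂ : Matrix (Fin d) (Fin d) ℝ} (hq₀ : q₀.IsSymm) (hq₁ : q₁.IsSymm) (hq₂ : q₂.IsSymm)
    (hq₀T : ∑ i, ∑ j, |q₀ i j| ≤ T₀) (hq₁T : ∑ i, ∑ j, |q₁ i j| ≤ T₀) (hq₂T : ∑ i, ∑ j, |q₂ i j| ≤ T₀)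
    {p ρ'' : ℝ} (hp : 0 ≤ p) (hρ''0 : 0 ≤ ρ'') (hρ'' : ρ'' < θbar) (hpρ : p * (1 + ρ) ≤ 1 + ρ'')
    {a b c₃ : ℝ} (ha : 0 ≤ a) (hb : 0 ≤ b) (hc₃ : 0 ≤ c₃) (habc : a + b + c₃ = 1) :
    StepKernelBounds (abkmWeightData L N Mord R θbar (schedDelta δ₀ δ₁ N) fun j => 𝒞 1 j) L k
      (weightIntConstRho θbar ρ'' (traceConst d Mord R lam (derivSum d n fun θ' _ => Cα θ' 0)))
      (p * secondDiffConst fun θ' => Cα θ' 0)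
      (fun x => p * (a * 𝒞 ((1 : Matrix (Fin d) (Fin d) ℝ) + q₀) (k + 1) x +
        b * 𝒞 ((1 : Matrix (Fin d) (Fin d) ℝ) + q₁) (k + 1) x + c₃ * 𝒞 ((1 : Matrix (Fin d) (Fin d) ℝ) + q₂) (k + 1) x)) := by
  have h8 : 8 ≤ 2 ^ (d + 3) := by
    calc 8 = 2 ^ 3 := by norm_num
      _ ≤ 2 ^ (d + 3) := Nat.pow_le_pow_right (by norm_num) (by omega)
  have hL2 : 2 ≤ L := by omega
  have hL1 : 1 ≤ L := by omega
  have hd2 : 2 ≤ d := by omega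
  have hL0 : (0 : ℝ) ≤ (L : ℝ) := Nat.cast_nonneg _
  have hK0 : 0 ≤ shellRatioConst c (Cℓ 1) (L : ℝ) d ñ := shellRatioConst_nonneg hc hC1 hL0 d ñ
  -- regularity of every elliptic family with the same constants (clause (iv), `ℓ = 0`)
  have hreg : ∀ A : Matrix (Fin d) (Fin d) ℝ, IsElliptic (1 / 2 : ℝ) 2 A →
      ∀ j, 1 ≤ j → j ≤ N + 1 → ∀ θ' : Fin d → ℕ, ∑ i, θ' i ≤ n → ∀ x,
        |iterDiff θ' (𝒞 A j) x| ≤ Cα θ' 0 / (L : ℝ) ^ ((j - 1) * (d - 2 + ∑ i, θ' i)) := by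
    intro A hA j hj1 hjN θ' hθ' x
    obtain ⟨-, hb⟩ := (hallA A hA).2.2.2.2.1 j hj1 hjN 0 isUnitSymm_zero
    have := hb θ' hθ' 0 x
    rw [iteratedDeriv_zero] at this
    simpa only [smul_zero, add_zero] using this
  -- the per-kernel facts for `A = 1 + m`, `m` symmetric in the ball
  have hfacts : ∀ {m : Matrix (Fin d) (Fin d) ℝ}, m.IsSymm → ∑ i, ∑ j, |m i j| ≤ T₀ →
      (∀ x, 𝒞 ((1 : Matrix (Fin d) (Fin d) ℝ) + m) (k + 1) (-x) = 𝒞 ((1 : Matrix (Fin d) (Fin d) ℝ) + m) (k + 1) x) ∧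
      (∀ κ, 0 ≤ (fourierCoeff (𝒞 ((1 : Matrix (Fin d) (Fin d) ℝ) + m) (k + 1)) κ).re) ∧
      (∀ κ, p * (fourierCoeff (𝒞 ((1 : Matrix (Fin d) (Fin d) ℝ) + m) (k + 1)) κ).re ≤
        (1 + ρ'') * cExt N (fun j => fourierCoeff (𝒞 1 j) κ) (k + 1)) ∧
      (∀ qi : quadIndex d, ((L ^ (d * k) : ℕ) : ℝ) *
        |gradCov (𝒞 ((1 : Matrix (Fin d) (Fin d) ℝ) + m) (k + 1)) qi| ≤ secondDiffConst fun θ' => Cα θ' 0) := by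
    intro m hm hmT
    obtain ⟨B, hBu, hmB⟩ := exists_isUnitSymm_eq_smul hm
    set T := ∑ i, ∑ j, |m i j| with hTdef
    have hT0 : 0 ≤ T := sum_nonneg fun _ _ => sum_nonneg fun _ _ => abs_nonneg _
    have hT : T ≤ 1 / 2 := hmT.trans hT₀
    have hKT : shellRatioConst c (Cℓ 1) (L : ℝ) d ñ * T ≤ Real.log (1 + ρ) :=
      (mul_le_mul_of_nonneg_left hmT hK0).trans hKT₀
    set A' : Matrix (Fin d) (Fin d) ℝ := 1 + m with hA'
    have hA'TB : A' = 1 + T • B := by rw [hA', hmB]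
    have hellA' : IsElliptic (1 / 2 : ℝ) 2 A' := by rw [hA'TB]; exact isElliptic_one_add_smul hBu hT0 hT
    have hqA := hallA A' hellA'
    refine ⟨(hqA.1 (k + 1) (by omega) hk).2, fun κ => ?_, fun κ => ?_, fun qi => ?_⟩
    · exact re_fourierCoeff_nonneg_of_torusFRD hqA.1 hqA.2.2.2.2.2 hc hL2 (by omega) hk κ
    · have hnn : 0 ≤ cExt N (fun j => fourierCoeff (𝒞 1 j) κ) (k + 1) := hB.multipliers_nonneg (k + 1) κ
      have h1 : (fourierCoeff (𝒞 A' (k + 1)) κ).re ≤ (1 + ρ) * cExt N (fun j => fourierCoeff (𝒞 1 j) κ) (k + 1) := by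
        rw [cExt_of_mem (f := fun j => fourierCoeff (𝒞 1 j) κ) (by omega) hk, hA'TB]
        exact re_fourierCoeff_one_add_smul_le (fun A hA => (hallA A hA).1) (fun A hA => (hallA A hA).2.2.2.2.1)
          (fun A hA => (hallA A hA).2.2.2.2.2) hc hC1 hL2 hnñ hBu hT0 hT (by omega) hk hρ0 hKT κ
      calc p * (fourierCoeff (𝒞 A' (k + 1)) κ).re ≤ p * ((1 + ρ) * cExt N (fun j => fourierCoeff (𝒞 1 j) κ) (k + 1)) :=
            mul_le_mul_of_nonneg_left h1 hp
        _ = p * (1 + ρ) * cExt N (fun j => fourierCoeff (𝒞 1 j) κ) (k + 1) := by ring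
        _ ≤ (1 + ρ'') * cExt N (fun j => fourierCoeff (𝒞 1 j) κ) (k + 1) :=
            mul_le_mul_of_nonneg_right hpρ hnn
    · exact abs_gradCov_abkm_le (𝒞 := fun j => 𝒞 A' j) hd2 hn2 hL1 (hreg A' hellA') hk qi
  obtain ⟨hev₀, hnn₀, hle₀, hγ₀⟩ := hfacts hq₀ hq₀T
  obtain ⟨hev₁, hnn₁, hle₁, hγ₁⟩ := hfacts hq₁ hq₁T
  obtain ⟨hev₂, hnn₂, hle₂, hγ₂⟩ := hfacts hq₂ hq₂T
  exact AbkmWeightBounds.stepKernelBounds_const_mul_convex3 hd2 hMord hMR hLodd hL hθbar hlam hB hn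
    (hreg 1 isElliptic_one) hk hρ''0 hρ'' hev₀ hev₁ hev₂ hnn₀ hnn₁ hnn₂ hp hle₀ hle₁ hle₂ hγ₀ hγ₁ hγ₂ ha hb hc₃ habc

end Package

end Literature.MathematicalPhysics.StatisticalMechanics.GradientRG

end
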